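import Summits.NavierStokesRegularity.NavierStokesRegularity.Theorems.OddMorawetzOddMorawetzLocalActFunctorial
import Summits.NavierStokesRegularity.NavierStokesRegularity.Theorems.OddMorawetzOddMorawetzLocalCoeffSemantics
import Summits.NavierStokesRegularity.NavierStokesRegularity.Theorems.OddMorawetzOddMorawetzLocalDerFirstOrder
import Summits.NavierStokesRegularity.NavierStokesRegularity.Theorems.OddMorawetzOddMorawetzLocalSmallLemmas
import Summits.NavierStokesRegularity.NavierStokesRegularity.Theorems.OddMorawetzOddMorawetzLocalIdxComplete
import HarnessLib

/-!
# Infinitesimal rotation invariance: `derMatrix k lieZ` kills an `O(3)`-fixed coefficient vector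

Crux `OddMorawetzLocal` (item stmt-NavierStokesRegularity-1376), refutation skeleton (line `registered`), stub
`derMatrix_lieZ_mulVec_eq_zero` (step E2); Mathlib polynomial / matrix API over the tree's computable jet algebra
(`OddMorawetzLocal/Negative/OddMorawetzLocalJetAlgebra`, `…RefutationDefs`) and the landed support lemmas
`actMatrix_map`, `act_smul_matrix`, `derMatrix_smul` (`…ActFunctorial`), `coeffOf_smul` (`…CoeffSemantics`),
`der_firstOrder` (`…DerFirstOrder`), `rotPath_mem_unitaryGroup` (`…SmallLemmas`), `canonical_of_mem_idx`
(`…IdxComplete`).  No named facts, no new definitions.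

After the isotropic reduction, the coefficient vector `τ : V k` of the certificate density is fixed by the action
matrix `actMatrix k G` of every orthogonal `G`.  This file extracts the infinitesimal consequence along the rotations
about the third axis: `(derMatrix k lieZ).mulVec τ = 0` — the integer linear system whose kernel the modular rank
certificates of the refutation then pin down.

Proof (no trigonometry, no exponential: everything is a polynomial identity in one real variable `t`).  The rational
rotation path `R(t)` with `cos = (1 - t²)/(1 + t²)`, `sin = 2t/(1 + t²)` is orthogonal for every real `t`
(`rotPath_mem_unitaryGroup`), and `(1 + t²) R(t)` is the evaluation at `t` of the polynomial matrix
`P = ((1 - X², -2X, 0), (2X, 1 - X², 0), (0, 0, 1 + X²))` with `P(0) = 1` and `P'(0) = 2 · lieZ`.  The action matrix is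
functorial in the coefficient ring (`actMatrix_map` with `evalRingHom t`) and homogeneous of degree `3 + k` in the
matrix (`actMatrix_smul`, from `act_smul_matrix`: every basis monomial of `idx k` has three variables and derivative
weight `k`), so `(actMatrix k P)(t) τ = (1 + t²)^(3+k) (actMatrix k R(t)) τ = (1 + t²)^(3+k) τ` for all real `t`; as
`ℝ` is infinite this is an identity of polynomials (`Polynomial.funext`), and its `X¹`-coefficient reads
`(actMatrix k P).map (coeff 1) τ = 0` (the right-hand side `(1 + X²)^(3+k)` has no linear term), i.e.
`derMatrix k (2 · lieZ) τ = 2 · derMatrix k lieZ τ = 0` by `der_firstOrder` and `derMatrix_smul`.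

Design note: the entries of `actMatrix k P` (a symbolic list computation over `idx k`) are only ever rewritten, never
unfolded or compared by definitional unfolding; the entrywise bookkeeping (`eval_sum_mul_C`, `coeff_sum_mul_C`) is
proved for a variable matrix and instantiated by `rw`.
-/

noncomputable section

-- the problem's tree path `NavierStokesRegularity/NavierStokesRegularity` duplicates a namespace component
set_option linter.dupNamespace false

open Polynomial

namespace Summit.NavierStokesRegularity.NavierStokesRegularity.Theorems.OddMorawetz

namespace E2Rotation

variable {R : Type} [CommRing R]

/-- **Homogeneity of the action matrix.**  `actMatrix k (c • g) = c ^ (3 + k) • actMatrix k g`: every monomial of the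
basis `idx k` has exactly three variables and derivative weight `k`, so the substitution action of `c • g` on it is
the action of `g` scaled by `c ^ (3 + k)` (`act_smul_matrix`; the scaled term list is literally `JPoly.smul`, whose
coefficients are `coeffOf_smul`). -/
theorem actMatrix_smul (k : ℕ) (c : R) (g : Matrix (Fin 3) (Fin 3) R) :
    actMatrix k (c • g) = c ^ (3 + k) • actMatrix k g := by
  ext i j
  obtain ⟨-, hlen, -, hw⟩ := canonical_of_mem_idx (List.get_mem (idx k) j)
  unfold actMatrix
  rw [Matrix.smul_apply, Matrix.of_apply, Matrix.of_apply, act_smul_matrix, hlen, hw, smul_eq_mul]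
  exact coeffOf_smul (c ^ (3 + k)) (JPoly.act g [(1, (idx k).get j)]) ((idx k).get i)

/-- The `X¹`-coefficient of `(1 + X²)ⁿ` vanishes. -/
theorem coeff_one_one_add_X_sq_pow (n : ℕ) : (((1 : R[X]) + X ^ 2) ^ n).coeff 1 = 0 := by
  induction n with
  | zero => simp [coeff_one]
  | succ n ih =>
    rw [pow_succ, DerFirstOrder.coeff_one_mul, ih]
    simp [coeff_one, coeff_X_pow]

/-- Evaluating at `t` the pairing of row `i` of a polynomial matrix with a constant vector gives the `i`-th entry of
the evaluated matrix applied to the vector. -/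
theorem eval_sum_mul_C {ι : Type} [Fintype ι] (A : Matrix ι ι ℝ[X]) (v : ι → ℝ) (i : ι) (t : ℝ) :
    (∑ j, A i j * C (v j)).eval t = (A.map (eval t)).mulVec v i := by
  rw [Matrix.mulVec_apply_eq_sum, eval_finsetSum]
  simp only [eval_mul, eval_C, Matrix.map_apply]

/-- The `Xⁿ`-coefficient of the pairing of row `i` of a polynomial matrix with a constant vector is the `i`-th entry of
the coefficient matrix applied to the vector. -/
theorem coeff_sum_mul_C {ι : Type} [Fintype ι] (A : Matrix ι ι ℝ[X]) (v : ι → ℝ) (i : ι) (n : ℕ) :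
    (∑ j, A i j * C (v j)).coeff n = (A.map fun p => p.coeff n).mulVec v i := by
  rw [Matrix.mulVec_apply_eq_sum, finsetSum_coeff]
  simp only [coeff_mul_C, Matrix.map_apply]

/-- **First-order consequence of invariance along a polynomial path.**  Let `P` be a polynomial `3 × 3` matrix with
`P(0) = 1` and suppose that for every real `t` the action matrix of `P(t)` multiplies `τ` by `q(t)` for a polynomial
`q` without linear term.  Then the derivation matrix of the tangent `P'(0)` kills `τ`: the row-wise identity
`Σ_j (actMatrix k P) i j · τ j = q · τ i` holds at every real `t`, hence as polynomials (`ℝ` is infinite), and its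
`X¹`-coefficient is `((actMatrix k P).map (coeff 1)) τ = 0 = derMatrix k (P'(0)) τ` by `der_firstOrder`. -/
theorem derMatrix_mulVec_eq_zero_of_path (k : ℕ) (τ : V k) (P : Matrix (Fin 3) (Fin 3) ℝ[X]) (q : ℝ[X])
    (h0 : P.map (fun p => p.coeff 0) = 1) (hq : q.coeff 1 = 0)
    (hP : ∀ t : ℝ, (actMatrix k (P.map (eval t))).mulVec τ = q.eval t • τ) :
    (derMatrix k (P.map fun p => p.coeff 1)).mulVec τ = 0 := by
  rw [← der_firstOrder k P h0]
  funext i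
  -- the polynomial identity in row `i`
  have hF : (∑ j, actMatrix k P i j * C (τ j)) = q * C (τ i) := by
    refine Polynomial.funext fun t => ?_
    rw [eval_sum_mul_C (actMatrix k P) τ i t, eval_mul, eval_C, ← coe_evalRingHom,
      ← actMatrix_map (evalRingHom t) k P, coe_evalRingHom, hP t, Pi.smul_apply, smul_eq_mul]
  -- its `X¹`-coefficient
  have hc := congrArg (fun p : ℝ[X] => p.coeff 1) hF
  rw [coeff_sum_mul_C (actMatrix k P) τ i 1, coeff_mul_C, hq, zero_mul] at hc
  rw [Pi.zero_apply]
  exact hc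

end E2Rotation

open E2Rotation in
/-- **Stub `derMatrix_lieZ_mulVec_eq_zero` (refutation of `OddMorawetzLocal`, step E2).**  A coefficient vector
`τ : V k` fixed by the action matrix of every orthogonal `3 × 3` matrix is killed by the derivation matrix of the
rotation generator `lieZ`: along the rational rotation path `R(t)` (`cos = (1 - t²)/(1 + t²)`, `sin = 2t/(1 + t²)`,
orthogonal for all real `t`) the polynomial matrix `P = (1 + X²) R` satisfies `P(0) = 1`, `P'(0) = 2 lieZ` and, by
homogeneity and functoriality of the action, `(actMatrix k P)(t) τ = (1 + t²)^(3+k) τ`; the `X¹`-coefficient of this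
polynomial identity is `2 · derMatrix k lieZ τ = 0`. -/
theorem derMatrix_lieZ_mulVec_eq_zero (k : ℕ) (τ : V k)
    (hfix : ∀ G ∈ Matrix.unitaryGroup (Fin 3) ℝ, (actMatrix k (G : Matrix (Fin 3) (Fin 3) ℝ)).mulVec τ = τ) :
    (derMatrix k (lieZ : Matrix (Fin 3) (Fin 3) ℝ)).mulVec τ = 0 := by
  -- the polynomial rotation path `P = (1 + X²) · R`, `R = ((cos, -sin, 0), (sin, cos, 0), (0, 0, 1))`
  set P : Matrix (Fin 3) (Fin 3) ℝ[X] := Matrix.of fun i j =>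
    if i = 0 ∧ j = 0 then 1 - X ^ 2 else if i = 0 ∧ j = 1 then -(C 2 * X) else
    if i = 1 ∧ j = 0 then C 2 * X else if i = 1 ∧ j = 1 then 1 - X ^ 2 else
    if i = 2 ∧ j = 2 then 1 + X ^ 2 else 0 with hP
  have h0 : P.map (fun p => p.coeff 0) = 1 := by
    ext i j
    fin_cases i <;> fin_cases j <;> simp [hP, coeff_one, coeff_X_pow, coeff_X]
  have h1 : P.map (fun p => p.coeff 1) = (2 : ℝ) • (lieZ : Matrix (Fin 3) (Fin 3) ℝ) := by
    ext i j
    fin_cases i <;> fin_cases j <;> simp [hP, lieZ, coeff_one, coeff_X_pow]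
  have hev : ∀ t : ℝ, P.map (eval t) = (1 + t ^ 2) • (Matrix.of fun i j : Fin 3 =>
      if i = 0 ∧ j = 0 then (1 - t ^ 2) / (1 + t ^ 2) else if i = 0 ∧ j = 1 then -(2 * t) / (1 + t ^ 2) else
      if i = 1 ∧ j = 0 then (2 * t) / (1 + t ^ 2) else if i = 1 ∧ j = 1 then (1 - t ^ 2) / (1 + t ^ 2) else
      if i = 2 ∧ j = 2 then 1 else 0 : Matrix (Fin 3) (Fin 3) ℝ) := by
    intro t
    have ht : (1 + t ^ 2 : ℝ) ≠ 0 := by positivity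
    ext i j
    fin_cases i <;> fin_cases j <;> simp [hP] <;> field_simp
  -- the action of `P(t)` on `τ` is multiplication by `(1 + t²)^(3+k)`
  have hpath : ∀ t : ℝ,
      (actMatrix k (P.map (eval t))).mulVec τ = (((1 : ℝ[X]) + X ^ 2) ^ (3 + k)).eval t • τ := by
    intro t
    rw [hev t, actMatrix_smul, Matrix.smul_mulVec, hfix _ (rotPath_mem_unitaryGroup t)]
    simp
  have h := derMatrix_mulVec_eq_zero_of_path k τ P (((1 : ℝ[X]) + X ^ 2) ^ (3 + k)) h0
    (coeff_one_one_add_X_sq_pow (3 + k)) hpath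
  rw [h1, derMatrix_smul, Matrix.smul_mulVec] at h
  exact (smul_eq_zero.mp h).resolve_left two_ne_zero

end Summit.NavierStokesRegularity.NavierStokesRegularity.Theorems.OddMorawetz

end
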